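import Summits.Ventures.PercRepro.S2LPInstances

/-!
# PercRepro — THE UNSPLIT INSTANCES OF THE LEVEL-5 LP, THE NULLITY-`0` CLASSES AND THE FLAT ZERO CLASSES (p2,
gen 30; SUBCLAIM-S2 feeder)

The upward and closure incidences of `S1CoreLPCells` / `S1CoreLPToolsFree` with the coloop count by NULLITY through
one function `rminL ν` (the least rank of a coloop-free set of nullity `ν` under the `e`-free flat bounds: `2`, `3`
for `ν ≤ 3`, `4` for `ν ≤ 6`, `5` for `ν ≤ 14`, `6` beyond), so that a cell consumer has one instance per row:
`up_inst` — `(n − k)·m[k,b] ≤ (b + 1 − rminL (k − b))·m[k+1,b+1] + (k+1)·m[k+1,b]`; `cl_inst_col` /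
`cl_inst_flat` — `(k − b + 1 + rminL (k − b + 1))·m[k+1,b] ≤ (F − k)·m[k,b]` with `F` the coloop-free flat bound
`n − (p − b + 1)` or the flat size `efreeL b`. Also: an independent set is its own coloops (the nullity-`0` class
has core size `0`), and the zero classes of a flat bound. Nothing is claimed about any cell.

* `rminL`, `efreeL`, `coloops_add_rminL_le_eRk`, **`up_inst`**, **`cl_inst_col`**, **`cl_inst_flat`**,
  `nuSets_zero_zero_eq`, `nuSets_zero_eq_empty`, `rkSets_eq_empty_of_flat`, `encard_eq_of_ncard`.
Axioms: standard.
-/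

open scoped Matroid

namespace PercRepro

namespace S2LP

open Set Finset

variable {α : Type} {M : Matroid α} [M.Finite]

/-- The least rank of a coloop-free set of nullity `ν` under the `e`-free flat bounds. -/
def rminL (ν : ℕ) : ℕ :=
  if ν = 0 then 0 else if ν = 1 then 2 else if ν ≤ 3 then 3 else if ν ≤ 6 then 4 else if ν ≤ 14 then 5 else 6

/-- The flat sizes of the `e`-free core at ranks `2 … 5`. -/
def efreeL (b : ℕ) : ℕ := if b ≤ 2 then 3 else if b = 3 then 6 else if b = 4 then 10 else 19

section Coloops

variable (hpairs : ∀ e ∈ M.E, ∀ f ∈ M.E, e ≠ f → M.eRk {e, f} = 2)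
  (hlines : ∀ L ⊆ M.E, M.eRk L = 2 → L.ncard ≤ 3) (hplanes : ∀ P ⊆ M.E, M.eRk P ≤ 3 → P.ncard ≤ 6)
  (htens : ∀ X ⊆ M.E, M.eRk X ≤ 4 → X.ncard ≤ 10) (hnineteen : ∀ X ⊆ M.E, M.eRk X ≤ 5 → X.ncard ≤ 19)
  (hE2 : 2 ≤ M.E.ncard)
include hpairs hlines hplanes htens hnineteen hE2

/-- **THE COLOOP COUNT BY NULLITY**: a set of rank `r` and nullity `ν ≥ 1` has at most `r − rminL ν` coloops. -/
theorem coloops_add_rminL_le_eRk {S : Set α} (hS : S ⊆ M.E) {r ν : ℕ} (hr : M.eRk S = (r : ℕ∞))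
    (hν : S.ncard = r + ν) (h1 : 1 ≤ ν) : {x ∈ S | M.eRk (S \ {x}) + 1 = M.eRk S}.ncard + rminL ν ≤ r := by
  unfold rminL
  split_ifs with h0 h1' h3 h6 h14
  · omega
  · exact S1.ncard_coloops_add_two_le_eRk hpairs hE2 hS hr (by omega)
  · exact S1.ncard_coloops_add_three_le_eRk_of_lines hpairs hlines hE2 hS hr (by omega)
  · exact S1.ncard_coloops_add_four_le_eRk_of_planes hpairs hlines hplanes hE2 hS hr (by omega)
  · exact S1.ncard_coloops_add_five_le_eRk_of_tens hpairs hlines hplanes htens hE2 hS hr (by omega)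
  · exact ncard_coloops_add_six_le_eRk_of_nineteen hpairs hlines hplanes htens hnineteen hE2 hS hr (by omega)

/-- **THE UNSPLIT UPWARD INSTANCE**: for `b < k`,
`(n − k)·m[k,b] ≤ (b + 1 − rminL (k − b))·m[k+1,b+1] + (k+1)·m[k+1,b]`. -/
theorem up_inst (k b : ℕ) (hkb : b < k) :
    (M.E.ncard - k) * (S1.rkSets M k b).ncard ≤
      (b + 1 - rminL (k - b)) * (S1.rkSets M (k + 1) (b + 1)).ncard + (k + 1) * (S1.rkSets M (k + 1) b).ncard := by
  refine S1.up_incidence k b _ ?_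
  intro S hS hSk hSb
  have h := coloops_add_rminL_le_eRk hpairs hlines hplanes htens hnineteen hE2 hS hSb (ν := k - b)
    (by rw [hSk]; omega) (by omega)
  rw [fibre_eq_coloopsOf hS hSb]
  simp only [coloopsOf]
  omega

/-- The lower fibre of the closure incidence: a `(k + 1)`-set of rank `b ≤ k` has at least
`k − b + 1 + rminL (k − b + 1)` non-coloops. -/
theorem lower_fibre (k b : ℕ) (hbk : b ≤ k) {S : Set α} (hS : S ⊆ M.E) (hSk : S.ncard = k + 1)
    (hSb : M.eRk S = (b : ℕ∞)) :
    k - b + 1 + rminL (k - b + 1) ≤ {x ∈ S | M.eRk (S \ {x}) = (b : ℕ∞)}.ncard := by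
  have h := coloops_add_rminL_le_eRk hpairs hlines hplanes htens hnineteen hE2 hS hSb (ν := k - b + 1)
    (by rw [hSk]; omega) (by omega)
  rw [fibre_eq_core hSb]
  have h2 := ncard_core_add_ncard_coloopsOf (M := M) hS
  rw [hSk] at h2
  simp only [coloopsOf] at h h2
  omega

/-- **THE UNSPLIT CLOSURE INSTANCE WITH THE COLOOP-FREE FLAT BOUND**: for `b ≤ k`, `b < p`,
`(k − b + 1 + rminL (k − b + 1))·m[k+1,b] ≤ (n − (p − b + 1) − k)·m[k,b]`. -/
theorem cl_inst_col {p : ℕ} (hM : M.eRank = (p : ℕ∞)) (hcol : M.coloops = ∅) (k b : ℕ) (hbk : b ≤ k)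
    (hbp : b < p) :
    (k - b + 1 + rminL (k - b + 1)) * (S1.rkSets M (k + 1) b).ncard ≤
      (M.E.ncard - (p - b + 1) - k) * (S1.rkSets M k b).ncard := by
  refine S1.closure_incidence k b _ _ ?_ ?_
  · intro S hS hSk hSb
    exact lower_fibre hpairs hlines hplanes htens hnineteen hE2 k b hbk hS hSk hSb
  · intro A hAE hAk hAb
    have := S1.ncard_extensions_add_le_of_coloops hM hcol hAE hAb hbp
    omega

/-- **THE UNSPLIT CLOSURE INSTANCE WITH A FLAT SIZE**: for `2 ≤ b ≤ 5`, `b ≤ k`,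
`(k − b + 1 + rminL (k − b + 1))·m[k+1,b] ≤ (efreeL b − k)·m[k,b]`. -/
theorem cl_inst_flat (k b : ℕ) (hbk : b ≤ k) (hb2 : 2 ≤ b) (hb5 : b ≤ 5) :
    (k - b + 1 + rminL (k - b + 1)) * (S1.rkSets M (k + 1) b).ncard ≤
      (efreeL b - k) * (S1.rkSets M k b).ncard := by
  refine S1.closure_incidence k b _ _ ?_ ?_
  · intro S hS hSk hSb
    exact lower_fibre hpairs hlines hplanes htens hnineteen hE2 k b hbk hS hSk hSb
  · intro A hAE hAk hAb
    have hflat : ∀ X ⊆ M.E, M.eRk X ≤ (b : ℕ∞) → X.ncard ≤ efreeL b := by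
      intro X hX hXb
      unfold efreeL
      split_ifs with h2 h3 h4
      · have hb : b = 2 := by omega
        rw [hb] at hXb
        rcases Nat.lt_or_ge X.ncard 2 with hlt | hge
        · omega
        · have h2r := S1.two_le_eRk_of_two_le_ncard hpairs hX hge
          have heq : M.eRk X = 2 := le_antisymm hXb h2r
          exact hlines X hX heq
      · rw [h3] at hXb; exact hplanes X hX hXb
      · rw [h4] at hXb; exact htens X hX hXb
      · have hb : b = 5 := by omega
        rw [hb] at hXb; exact hnineteen X hX hXb
    have := S1.ncard_extensions_add_le_of_flat hflat hAE hAb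
    omega

end Coloops

section ZeroClasses

/-- **THE NULLITY-`0` CLASS**: an independent `k`-set is its own coloops, so its core is empty —
`nuSets k 0 0 = rkSets k k`. -/
theorem nuSets_zero_zero_eq (k : ℕ) : nuSets M k 0 0 = S1.rkSets M k k := by
  ext S
  simp only [mem_nuSets, Nat.sub_zero]
  constructor
  · rintro ⟨h, -⟩; exact h
  · rintro ⟨hSE, hSk, hSr⟩
    refine ⟨⟨hSE, hSk, hSr⟩, ?_⟩
    rw [ncard_eq_zero ((M.ground_finite.subset hSE).subset (core_subset S))]
    -- every element is a coloop: `ρ(S ∖ x) ≤ |S| − 1 < |S| = ρ(S)`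
    ext x
    simp only [core, mem_sdiff, coloopsOf, mem_setOf_eq, mem_empty_iff_false, iff_false, not_and]
    intro hx hnot
    apply hnot hx
    have hfin : S.Finite := M.ground_finite.subset hSE
    have hle : M.eRk (S \ {x}) ≤ (S \ {x}).encard := M.eRk_le_encard _
    rw [← hfin.sdiff.cast_ncard_eq, ncard_sdiff_singleton_of_mem hx, hSk] at hle
    have hge : M.eRk S ≤ M.eRk (S \ {x}) + 1 := by
      have := M.eRk_insert_le_add_one x (S \ {x})
      rwa [insert_sdiff_singleton, insert_eq_of_mem hx] at this
    rw [hSr] at hge ⊢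
    have hpos : 1 ≤ k := by rw [← hSk]; exact (ncard_pos hfin).2 ⟨x, hx⟩
    have hfin' : M.eRk (S \ {x}) ≠ ⊤ := ne_top_of_le_ne_top (ENat.coe_ne_top _) hle
    obtain ⟨a, ha⟩ := ENat.ne_top_iff_exists.1 hfin'
    rw [← ha] at hle hge ⊢
    have h1 : a ≤ k - 1 := by exact_mod_cast hle
    have h2 : k ≤ a + 1 := by exact_mod_cast hge
    have : a + 1 = k := by omega
    exact_mod_cast this

/-- The nullity-`0` classes of positive core size are empty. -/
theorem nuSets_zero_eq_empty (k s : ℕ) (hs : 1 ≤ s) : nuSets M k 0 s = ∅ := by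
  ext S
  simp only [mem_empty_iff_false, iff_false]
  rintro ⟨h, hcore⟩
  have h0 : S ∈ nuSets M k 0 0 := by
    rw [nuSets_zero_zero_eq]; simpa using h
  have := h0.2
  omega

omit [M.Finite] in
/-- **THE ZERO CLASSES OF A FLAT BOUND**: if every set of rank `≤ b` has at most `F` points, there is no `k`-set of
rank `r ≤ b` with `k > F`. -/
theorem rkSets_eq_empty_of_flat {b F : ℕ} (hflat : ∀ X ⊆ M.E, M.eRk X ≤ (b : ℕ∞) → X.ncard ≤ F) {k r : ℕ}
    (hr : r ≤ b) (hk : F < k) : S1.rkSets M k r = ∅ := by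
  ext S
  simp only [mem_empty_iff_false, iff_false]
  rintro ⟨hSE, hSk, hSr⟩
  have := hflat S hSE (by rw [hSr]; exact_mod_cast hr)
  omega

omit [M.Finite] in
/-- `|E| = r(M) + d` as `encard` from the `ncard` data. -/
theorem encard_eq_of_ncard {p n d : ℕ} (hfin : M.E.Finite) (hM : M.eRank = (p : ℕ∞)) (hn : M.E.ncard = n)
    (hd : n = p + d) : M.E.encard = M.eRank + d := by
  rw [hM, ← hfin.cast_ncard_eq, hn, hd]; push_cast; rfl

end ZeroClasses

end S2LP

end PercRepro
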